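import Literature.Probability.Percolation.TwoArmQuasiMult
import Literature.Probability.Percolation.ArmEventsAPrioriPoly
import Literature.Probability.Percolation.OneArmAnnulusQuasiMult
import HarnessLib

/-!
# Quasi-multiplicativity of arm probabilities: the normal form "`n₂ ≥ A n₁`", and the cases `j ≤ 2`

Topic: Probability / Percolation; family `crit-perc` (critical site percolation `P = P_{1/2} =
triSitePercolation half` on the triangular lattice `𝕋`, hexagonal annuli `Λ_N ∖ Λ_n`,
`Λ_n = triBall n`; the order-free arm events `armEvent κ n N` and their probabilities
`polyArmProb κ n N` of `ArmEvents.lean`). Bricks for the named fact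
`Literature.Probability.Percolation.Nolin2008_prop17_quasiMult` (`FiveArmExponentFacts.lean`;
P. Nolin, *Near-critical percolation in two dimensions*, EJP 13 (2008), §4.5, Prop. 17
[arXiv 0711.4948: Prop. 16]: "`P̂(A_{j,σ}(n₁,n₂)) P̂(A_{j,σ}(n₂,n₃)) ≍ P̂(A_{j,σ}(n₁,n₃))`"), whose
recorded form is, for every `k` and every `κ : Fin k → Bool`,
`∃ c > 0, ∃ n₀, ∀ n₀ ≤ n₁ < n₂ < n₃, c · π(n₁,n₂) · π(n₂,n₃) ≤ π(n₁,n₃)` (`π = polyArmProb κ`).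
Everything here is PROVED; no definition and no named fact is introduced.

* `polyArmProb_quasiMult_of_spaced` — **the normal form** of Nolin's proof of Prop. 17 ("We may
  assume that `n₂ ≥ 8 n₁`"): for any colour sequence `κ` and any ratio `A ≥ 2`, the general
  statement follows from (i) quasi-multiplicativity along WELL-SPACED radii `A n₁ ≤ n₂`,
  `A n₂ ≤ n₃`, and (ii) the a-priori lower bound at BOUNDED ratio, `a ≤ π(m, N)` for
  `m₀ ≤ m ≤ N ≤ A² m` (Nolin, Prop. 14 [arXiv Prop. 13], lower half, with extendability Prop. 16
  [arXiv Prop. 15]); the bounded-ratio cases are settled by (ii) and the monotonicity of `π` in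
  both radii (`polyArmProb_anti_holds`, `polyArmProb_mono_left`), exactly as in the tree's
  `Nolin2008_twoArm_quasiMult_of_separation` (`ArmSeparationProofs.lean`, `j = 2`), of which this
  is the colour-blind skeleton.
* `exists_le_polyArmProb_of_le_mul` — (ii) for `k ≤ 6` arms of any colours and any ratio, from
  the RSW a-priori bound `exists_rpow_le_polyArmProb_of_le_six` (`ArmEventsAPrioriPoly.lean`).
* `armEvent_fin_zero`, `polyArmProb_fin_zero`, `polyArmProb_quasiMult_fin_zero` — the degenerate
  case `j = 0` of the recorded fact (`armEvent = univ`, `π = 1`, `c = 1`).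
* `polyArmProb_quasiMult_fin_one`, `polyArmProb_quasiMult_of_le_one` — the case `j = 1`, both
  colours: the well-spaced RSW gluing `polyArmProb_one_quasiMult_spaced`
  (`OneArmAnnulusQuasiMult.lean`; Nolin, §6.2, footnote: "in the case of one arm … direct
  consequences of RSW") fed, with ratio `A = 4`, into the normal form together with (ii).
* `polyArmProb_two_swap`, `polyArmProb_quasiMult_two_of_ne` — the case `j = 2`, BOTH
  polychromatic colour sequences `(T,F)`, `(F,T)`: the tree's theorem
  `Nolin2008_twoArm_quasiMult_holds` (`TwoArmQuasiMult.lean`, `κ = (T,F)`) and colour exchange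
  at `p = 1/2` (`polyArmProb_not`).

What is NOT here: the monochromatic `j = 2` sequences `(T,T)`, `(F,F)` and all `j ≥ 3`, which
need Nolin's arm-separation theorem (Thm. 11 [arXiv Thm. 10]) for the corresponding `(j, σ)` — two
arms of the SAME colour must be kept disjoint through the separation and gluing constructions; the
tree has the theorem for `j = 2`, `σ = BW` only (`Nolin2008_twoArm_separation_holds`), where
disjointness is automatic.

## References

* P. Nolin, *Near-critical percolation in two dimensions*, Electron. J. Probab. 13 (2008),
  1562–1623, §4.3 Prop. 14, §4.5 Prop. 16–17 [arXiv 0711.4948: Prop. 13, Prop. 15–16; EJP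
  number = arXiv number + 1]. [Nolin2008]
* S. Smirnov, W. Werner, *Critical exponents for two-dimensional percolation*, Math. Res. Lett. 8
  (2001), 729–744, §4 (10) and Rem. 2 (colour exchange). [SmirnovWernerMRL2001]

Mathlib: `min`, `Nat` division lemmas (`Nat.mul_div_le`, `Nat.lt_div_mul_add`,
`Nat.le_div_iff_mul_le`, `Nat.div_lt_iff_lt_mul`); no percolation in Mathlib. Tree:
`polyArmProb_anti_holds`, `polyArmProb_nonneg`, `polyArmProb_le_one` (`ArmEventsProofs.lean`),
`polyArmProb_mono_left`, `Nolin2008_twoArm_quasiMult_of_separation` (`ArmSeparationProofs.lean`),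
`Nolin2008_twoArm_quasiMult_holds` (`TwoArmQuasiMult.lean`), `polyArmProb_not`
(`ArmEventsStructure.lean`), `exists_rpow_le_polyArmProb_of_le_six` (`ArmEventsAPrioriPoly.lean`),
`polyArmProb_one_quasiMult_spaced` (`OneArmAnnulusQuasiMult.lean`).
-/

noncomputable section

open MeasureTheory Set

namespace Literature.Probability.Percolation

open LatticeModels

/-! ### The normal form: well-spaced radii and bounded ratios suffice -/

/-- **Normal form of quasi-multiplicativity** (Nolin 2008, proof of Prop. 17 [arXiv 0711.4948:
Prop. 16]: "We may assume that `n₂ ≥ 8 n₁`: otherwise … the extendability property … allows to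
conclude"). Fix a colour sequence `κ` and a ratio `A ≥ 2`. If (ii) `a ≤ π(m, N)` whenever
`m₀ ≤ m ≤ N ≤ A² m` (a-priori bound at bounded ratio) and (i)
`c · π(n₁,n₂) π(n₂,n₃) ≤ π(n₁,n₃)` whenever `n₀ ≤ n₁`, `A n₁ ≤ n₂`, `A n₂ ≤ n₃` (the well-spaced
case), then `min c 1 · min a 1 · π(n₁,n₂) π(n₂,n₃) ≤ π(n₁,n₃)` for ALL
`max (max n₀ m₀) 1 ≤ n₁ < n₂ < n₃` (`π = polyArmProb κ`). The four bounded-ratio cases: if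
`A n₁ ≤ n₂` but `n₃ < A n₂`, either `A² n₁ ≤ n₃` and the middle radius is moved down to
`⌊n₃ / A⌋ ≤ n₂` (`π(n₁, ·)` is non-increasing, `π(⌊n₃/A⌋, n₃) ≥ a`), or `n₃ < A² n₁` and
`π(n₁,n₃) ≥ a` directly; if `n₂ < A n₁`, either `A² n₁ ≤ n₃` and the middle radius is moved up
to `A n₁` (`π(·, n₃)` is non-decreasing, `π(n₁, A n₁) ≥ a`), or `π(n₁,n₃) ≥ a` directly. [cite: Nolin2008, §4.5 Prop. 17, proof (arXiv 0711.4948: Prop. 16)] -/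
theorem polyArmProb_quasiMult_of_spaced {k : ℕ} (κ : Fin k → Bool) {A : ℕ} (hA : 2 ≤ A)
    {a : ℝ} (ha : 0 < a) {m₀ : ℕ}
    (hbdd : ∀ m N : ℕ, m₀ ≤ m → m ≤ N → N ≤ A * (A * m) → a ≤ polyArmProb κ m N)
    {c : ℝ} (hc : 0 < c) {n₀ : ℕ}
    (hsp : ∀ n₁ n₂ n₃ : ℕ, n₀ ≤ n₁ → A * n₁ ≤ n₂ → A * n₂ ≤ n₃ →
      c * (polyArmProb κ n₁ n₂ * polyArmProb κ n₂ n₃) ≤ polyArmProb κ n₁ n₃) :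
    ∀ n₁ n₂ n₃ : ℕ, max (max n₀ m₀) 1 ≤ n₁ → n₁ < n₂ → n₂ < n₃ →
      min c 1 * min a 1 * (polyArmProb κ n₁ n₂ * polyArmProb κ n₂ n₃) ≤ polyArmProb κ n₁ n₃ := by
  intro n₁ n₂ n₃ h₀ h₁₂ h₂₃
  have hn₀ : n₀ ≤ n₁ := le_trans (le_max_left _ _) (le_of_max_le_left h₀)
  have hm₀ : m₀ ≤ n₁ := le_trans (le_max_right _ _) (le_of_max_le_left h₀)
  have hn₁ : 1 ≤ n₁ := le_of_max_le_right h₀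
  have hA0 : 0 < A := by omega
  set c₁ : ℝ := min c 1 with hc₁
  set a₁ : ℝ := min a 1 with ha₁
  have hc₁0 : 0 < c₁ := lt_min hc one_pos
  have ha₁0 : 0 < a₁ := lt_min ha one_pos
  have hc₁c : c₁ ≤ c := min_le_left _ _
  have hc₁1 : c₁ ≤ 1 := min_le_right _ _
  have ha₁a : a₁ ≤ a := min_le_left _ _
  have ha₁1 : a₁ ≤ 1 := min_le_right _ _
  have b₁₂0 := polyArmProb_nonneg κ n₁ n₂
  have b₂₃0 := polyArmProb_nonneg κ n₂ n₃
  have b₁₂1 := polyArmProb_le_one κ n₁ n₂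
  have b₂₃1 := polyArmProb_le_one κ n₂ n₃
  have hprod0 : 0 ≤ polyArmProb κ n₁ n₂ * polyArmProb κ n₂ n₃ := mul_nonneg b₁₂0 b₂₃0
  have hprod1 : polyArmProb κ n₁ n₂ * polyArmProb κ n₂ n₃ ≤ 1 := mul_le_one₀ b₁₂1 b₂₃0 b₂₃1
  -- the bounded-ratio conclusion `c₁ a₁ π π ≤ a ≤ π(n₁, n₃)`
  have direct : n₃ ≤ A * (A * n₁) → c₁ * a₁ * (polyArmProb κ n₁ n₂ * polyArmProb κ n₂ n₃) ≤ polyArmProb κ n₁ n₃ := by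
    intro h3
    calc c₁ * a₁ * (polyArmProb κ n₁ n₂ * polyArmProb κ n₂ n₃) ≤ c₁ * a₁ :=
          mul_le_of_le_one_right (by positivity) hprod1
      _ ≤ 1 * a := mul_le_mul hc₁1 ha₁a ha₁0.le zero_le_one
      _ = a := one_mul a
      _ ≤ polyArmProb κ n₁ n₃ := hbdd n₁ n₃ hm₀ (by omega) h3
  -- arithmetic of the ratio `A`
  have hAn₁ : n₁ ≤ A * n₁ := Nat.le_mul_of_pos_left _ hA0
  have hAAn₁ : A * n₁ ≤ A * (A * n₁) := Nat.mul_le_mul_left A hAn₁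
  by_cases hX : A * n₁ ≤ n₂
  · by_cases hY : A * n₂ ≤ n₃
    · -- well-spaced radii
      calc c₁ * a₁ * (polyArmProb κ n₁ n₂ * polyArmProb κ n₂ n₃)
          ≤ c * 1 * (polyArmProb κ n₁ n₂ * polyArmProb κ n₂ n₃) :=
            mul_le_mul_of_nonneg_right (mul_le_mul hc₁c ha₁1 ha₁0.le hc.le) hprod0
        _ = c * (polyArmProb κ n₁ n₂ * polyArmProb κ n₂ n₃) := by rw [mul_one]
        _ ≤ polyArmProb κ n₁ n₃ := hsp n₁ n₂ n₃ hn₀ hX hY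
    · push Not at hY
      by_cases hZ : A * (A * n₁) ≤ n₃
      · -- move the middle radius down to `M = ⌊n₃ / A⌋ ≤ n₂`
        set M : ℕ := n₃ / A with hM
        have hAM : A * M ≤ n₃ := Nat.mul_div_le n₃ A
        have hMA : n₃ < A * M + A := by
          have := Nat.lt_div_mul_add (a := n₃) hA0; rwa [Nat.mul_comm] at this
        have hn₁M : A * n₁ ≤ M := (Nat.le_div_iff_mul_le hA0).2 (by rw [Nat.mul_comm]; exact hZ)
        have hMn₂ : M < n₂ := (Nat.div_lt_iff_lt_mul hA0).2 (by rw [Nat.mul_comm]; exact hY)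
        have hM1 : 1 ≤ M := le_trans (le_trans hn₁ hAn₁) hn₁M
        have hAM1 : A ≤ A * M := by
          have := Nat.mul_le_mul_left A hM1; rwa [Nat.mul_one] at this
        have h2AM : 2 * (A * M) ≤ A * (A * M) := Nat.mul_le_mul_right _ hA
        have hbd : n₃ ≤ A * (A * M) := by omega
        have e1 : polyArmProb κ n₁ n₂ ≤ polyArmProb κ n₁ M := polyArmProb_anti_holds κ (by omega) hMn₂.le
        have e2 : a ≤ polyArmProb κ M n₃ := hbdd M n₃ (by omega) (by omega) hbd
        have e3 := hsp n₁ M n₃ hn₀ hn₁M hAM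
        have hM0 := polyArmProb_nonneg κ n₁ M
        calc c₁ * a₁ * (polyArmProb κ n₁ n₂ * polyArmProb κ n₂ n₃)
            ≤ c₁ * a₁ * (polyArmProb κ n₁ n₂ * 1) :=
              mul_le_mul_of_nonneg_left (mul_le_mul_of_nonneg_left b₂₃1 b₁₂0) (by positivity)
          _ = c₁ * polyArmProb κ n₁ n₂ * a₁ := by ring
          _ ≤ c * polyArmProb κ n₁ M * polyArmProb κ M n₃ :=
              mul_le_mul (mul_le_mul hc₁c e1 b₁₂0 hc.le) (ha₁a.trans e2) ha₁0.le (mul_nonneg hc.le hM0)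
          _ = c * (polyArmProb κ n₁ M * polyArmProb κ M n₃) := by ring
          _ ≤ polyArmProb κ n₁ n₃ := e3
      · push Not at hZ
        exact direct hZ.le
  · push Not at hX
    by_cases hZ : A * (A * n₁) ≤ n₃
    · -- move the middle radius up to `A n₁ ≥ n₂`
      have e1 : a ≤ polyArmProb κ n₁ (A * n₁) := hbdd n₁ (A * n₁) hm₀ hAn₁ hAAn₁
      have e2 : polyArmProb κ n₂ n₃ ≤ polyArmProb κ (A * n₁) n₃ :=
        polyArmProb_mono_left κ hX.le (le_trans hAAn₁ hZ)
      have e3 := hsp n₁ (A * n₁) n₃ hn₀ le_rfl hZ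
      have hM0 := polyArmProb_nonneg κ n₁ (A * n₁)
      calc c₁ * a₁ * (polyArmProb κ n₁ n₂ * polyArmProb κ n₂ n₃)
          ≤ c₁ * a₁ * (1 * polyArmProb κ n₂ n₃) :=
            mul_le_mul_of_nonneg_left (mul_le_mul_of_nonneg_right b₁₂1 b₂₃0) (by positivity)
        _ = c₁ * a₁ * polyArmProb κ n₂ n₃ := by ring
        _ ≤ c * polyArmProb κ n₁ (A * n₁) * polyArmProb κ (A * n₁) n₃ :=
            mul_le_mul (mul_le_mul hc₁c (ha₁a.trans e1) ha₁0.le hc.le) e2 b₂₃0 (mul_nonneg hc.le hM0)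
        _ = c * (polyArmProb κ n₁ (A * n₁) * polyArmProb κ (A * n₁) n₃) := by ring
        _ ≤ polyArmProb κ n₁ n₃ := e3
    · push Not at hZ
      exact direct hZ.le

/-- **The recorded `∀∃` form from the two inputs** (same content as
`polyArmProb_quasiMult_of_spaced`, with the constants and thresholds hidden in existentials):
a-priori positivity at bounded ratio `A²` plus quasi-multiplicativity at spacing `A` give the
quasi-multiplicativity clause of `Nolin2008_prop17_quasiMult` for the colour sequence `κ`. [cite: Nolin2008, §4.5 Prop. 17, proof (arXiv 0711.4948: Prop. 16)] -/
theorem polyArmProb_quasiMult_of_spaced' {k : ℕ} (κ : Fin k → Bool) {A : ℕ} (hA : 2 ≤ A)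
    (hbdd : ∃ a : ℝ, 0 < a ∧ ∃ m₀ : ℕ, ∀ m N : ℕ, m₀ ≤ m → m ≤ N → N ≤ A * (A * m) → a ≤ polyArmProb κ m N)
    (hsp : ∃ c : ℝ, 0 < c ∧ ∃ n₀ : ℕ, ∀ n₁ n₂ n₃ : ℕ, n₀ ≤ n₁ → A * n₁ ≤ n₂ → A * n₂ ≤ n₃ →
      c * (polyArmProb κ n₁ n₂ * polyArmProb κ n₂ n₃) ≤ polyArmProb κ n₁ n₃) :
    ∃ c : ℝ, 0 < c ∧ ∃ n₀ : ℕ, ∀ n₁ n₂ n₃ : ℕ, n₀ ≤ n₁ → n₁ < n₂ → n₂ < n₃ →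
      c * (polyArmProb κ n₁ n₂ * polyArmProb κ n₂ n₃) ≤ polyArmProb κ n₁ n₃ := by
  obtain ⟨a, ha, m₀, hbdd⟩ := hbdd
  obtain ⟨c, hc, n₀, hsp⟩ := hsp
  exact ⟨min c 1 * min a 1, mul_pos (lt_min hc one_pos) (lt_min ha one_pos), max (max n₀ m₀) 1,
    polyArmProb_quasiMult_of_spaced κ hA ha hbdd hc hsp⟩

/-- **A-priori positivity at bounded ratio for at most six arms** (Nolin 2008, Prop. 14
[arXiv 0711.4948: Prop. 13], lower half, with §4.1 item 3; Smirnov–Werner 2001, §4.2 "by standard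
RSW theory"): for `k ≤ 6`, any colours `κ` and any ratio `B`, there is `a > 0` with
`a ≤ P_{1/2}(armEvent κ m N)` whenever `3 ≤ m ≤ N ≤ B m` (from the power-law bound
`exists_rpow_le_polyArmProb_of_le_six`). [cite: Nolin2008, Prop. 14 (arXiv 0711.4948: Prop. 13)] -/
theorem exists_le_polyArmProb_of_le_mul {k : ℕ} (hk : k ≤ 6) (κ : Fin k → Bool) (B : ℕ) (hB : 1 ≤ B) :
    ∃ a : ℝ, 0 < a ∧ ∀ m N : ℕ, 3 ≤ m → m ≤ N → N ≤ B * m → a ≤ polyArmProb κ m N := by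
  obtain ⟨c, ζ, hc, hζ, h⟩ := exists_rpow_le_polyArmProb_of_le_six
  have hB0 : (0 : ℝ) < B := by exact_mod_cast hB
  refine ⟨c * (1 / (B : ℝ)) ^ ζ, by positivity, fun m N hm hmN hN => le_trans ?_ (h k hk κ m N hm hmN)⟩
  have hm' : (0 : ℝ) < m := by exact_mod_cast (lt_of_lt_of_le (by norm_num) hm)
  have hN' : (0 : ℝ) < N := by exact_mod_cast (lt_of_lt_of_le (lt_of_lt_of_le (by norm_num) hm) hmN)
  have hratio : (1 / (B : ℝ)) ≤ (m : ℝ) / N := by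
    rw [div_le_div_iff₀ hB0 hN']
    have : (N : ℝ) ≤ B * m := by exact_mod_cast hN
    linarith
  exact mul_le_mul_of_nonneg_left (Real.rpow_le_rpow (by positivity) hratio hζ.le) hc.le

/-! ### No arms: `j = 0` -/

/-- With no arms required, the arm event is the sure event. [cite: SmirnovWernerMRL2001, §3] -/
theorem armEvent_fin_zero (κ : Fin 0 → Bool) (r R : ℕ) : armEvent κ r R = univ := by
  refine eq_univ_of_forall fun ω => ?_
  exact ⟨fun j => j.elim0, fun j => j.elim0, fun j => j.elim0, fun j => j.elim0, fun i => i.elim0⟩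

/-- With no arms required, the arm probability is `1`. [cite: SmirnovWernerMRL2001, §3] -/
theorem polyArmProb_fin_zero (κ : Fin 0 → Bool) (r R : ℕ) : polyArmProb κ r R = 1 := by
  rw [polyArmProb, armEvent_fin_zero]; simp

/-- **The case `j = 0` of `Nolin2008_prop17_quasiMult`** (degenerate: `π ≡ 1`, `c = 1`, `n₀ = 0`). [cite: Nolin2008, §4.5 Prop. 17 (arXiv 0711.4948: Prop. 16)] -/
theorem polyArmProb_quasiMult_fin_zero (κ : Fin 0 → Bool) :
    ∃ c : ℝ, 0 < c ∧ ∃ n₀ : ℕ, ∀ n₁ n₂ n₃ : ℕ, n₀ ≤ n₁ → n₁ < n₂ → n₂ < n₃ →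
      c * (polyArmProb κ n₁ n₂ * polyArmProb κ n₂ n₃) ≤ polyArmProb κ n₁ n₃ :=
  ⟨1, one_pos, 0, fun n₁ n₂ n₃ _ _ _ => by simp [polyArmProb_fin_zero]⟩

/-! ### One arm: `j = 1` -/

/-- **The case `j = 1` of `Nolin2008_prop17_quasiMult`** (Nolin 2008, Prop. 17 [arXiv Prop. 16]
for one arm; §6.2, footnote: "in the case of one arm, the extendability property, as well as the
quasi-multiplicativity, are direct consequences of RSW and do not require the separation lemmas"):
for every `κ : Fin 1 → Bool`, `∃ c > 0, ∃ n₀, ∀ n₀ ≤ n₁ < n₂ < n₃, c · π(n₁,n₂) π(n₂,n₃) ≤ π(n₁,n₃)`.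
The normal form at ratio `A = 4` with the RSW gluing `polyArmProb_one_quasiMult_spaced` as (i) and
the a-priori bound `exists_le_polyArmProb_of_le_mul` (ratio `16`) as (ii). [cite: Nolin2008, §4.5 Prop. 17 (arXiv 0711.4948: Prop. 16), j = 1] -/
theorem polyArmProb_quasiMult_fin_one (κ : Fin 1 → Bool) :
    ∃ c : ℝ, 0 < c ∧ ∃ n₀ : ℕ, ∀ n₁ n₂ n₃ : ℕ, n₀ ≤ n₁ → n₁ < n₂ → n₂ < n₃ →
      c * (polyArmProb κ n₁ n₂ * polyArmProb κ n₂ n₃) ≤ polyArmProb κ n₁ n₃ := by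
  refine polyArmProb_quasiMult_of_spaced' κ (A := 4) (by norm_num) ?_ ?_
  · obtain ⟨a, ha, h⟩ := exists_le_polyArmProb_of_le_mul (show 1 ≤ 6 by norm_num) κ 16 (by norm_num)
    exact ⟨a, ha, 3, fun m N hm hmN hN => h m N hm hmN (by omega)⟩
  · obtain ⟨c, hc, h⟩ := polyArmProb_one_quasiMult_spaced κ
    exact ⟨c, hc, 1000, h⟩

/-- **`Nolin2008_prop17_quasiMult` for at most one arm** (`k ≤ 1`: the cases `j = 0` and `j = 1`). [cite: Nolin2008, §4.5 Prop. 17 (arXiv 0711.4948: Prop. 16)] -/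
theorem polyArmProb_quasiMult_of_le_one {k : ℕ} (hk : k ≤ 1) (κ : Fin k → Bool) :
    ∃ c : ℝ, 0 < c ∧ ∃ n₀ : ℕ, ∀ n₁ n₂ n₃ : ℕ, n₀ ≤ n₁ → n₁ < n₂ → n₂ < n₃ →
      c * (polyArmProb κ n₁ n₂ * polyArmProb κ n₂ n₃) ≤ polyArmProb κ n₁ n₃ := by
  interval_cases k
  · exact polyArmProb_quasiMult_fin_zero κ
  · exact polyArmProb_quasiMult_fin_one κ

/-! ### Two polychromatic arms: `j = 2`, `κ ∈ {(T,F), (F,T)}` -/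

/-- Exchanging the two colours of the polychromatic two-arm event does not change its probability
at `p = 1/2` (`(F,T) = ¬(T,F)` and colour exchange, `polyArmProb_not`; equivalently, relabelling
of the two arms). [cite: SmirnovWernerMRL2001, Rem. 2] -/
theorem polyArmProb_two_swap (r R : ℕ) : polyArmProb ![false, true] r R = polyArmProb ![true, false] r R := by
  have h := polyArmProb_not ![true, false] r R
  have e : (fun j => !(![true, false] : Fin 2 → Bool) j) = ![false, true] := by
    funext i; fin_cases i <;> rfl
  rwa [e] at h

/-- A two-colour sequence taking both values is `(T,F)` or `(F,T)`. [folklore] -/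
theorem fin_two_eq_of_ne (κ : Fin 2 → Bool) (h : κ 0 ≠ κ 1) : κ = ![true, false] ∨ κ = ![false, true] := by
  have hκ : κ = ![κ 0, κ 1] := by funext i; fin_cases i <;> rfl
  rw [hκ]
  revert h
  generalize κ 0 = b₀
  generalize κ 1 = b₁
  intro h
  cases b₀ <;> cases b₁
  · exact absurd rfl h
  · exact Or.inr rfl
  · exact Or.inl rfl
  · exact absurd rfl h

/-- **The case `j = 2`, polychromatic, of `Nolin2008_prop17_quasiMult`**: for `κ : Fin 2 → Bool`
taking both values, `∃ c > 0, ∃ n₀, ∀ n₀ ≤ n₁ < n₂ < n₃, c · π(n₁,n₂) π(n₂,n₃) ≤ π(n₁,n₃)` — the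
tree's theorem `Nolin2008_twoArm_quasiMult_holds` (Nolin's Prop. 17 for `σ = BW`, from his
arm-separation Thm. 11) transported to `(F,T)` by colour exchange. [cite: Nolin2008, §4.5 Prop. 17 (arXiv 0711.4948: Prop. 16)] [cite: SmirnovWernerMRL2001, Rem. 2] -/
theorem polyArmProb_quasiMult_two_of_ne (κ : Fin 2 → Bool) (h : κ 0 ≠ κ 1) :
    ∃ c : ℝ, 0 < c ∧ ∃ n₀ : ℕ, ∀ n₁ n₂ n₃ : ℕ, n₀ ≤ n₁ → n₁ < n₂ → n₂ < n₃ →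
      c * (polyArmProb κ n₁ n₂ * polyArmProb κ n₂ n₃) ≤ polyArmProb κ n₁ n₃ := by
  obtain ⟨c, hc, n₀, hq⟩ := Nolin2008_twoArm_quasiMult_holds
  refine ⟨c, hc, n₀, fun n₁ n₂ n₃ h₀ h₁₂ h₂₃ => ?_⟩
  rcases fin_two_eq_of_ne κ h with rfl | rfl
  · exact hq n₁ n₂ n₃ h₀ h₁₂ h₂₃
  · simpa only [polyArmProb_two_swap] using hq n₁ n₂ n₃ h₀ h₁₂ h₂₃

end Literature.Probability.Percolation

end
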